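import Literature.MathematicalPhysics.QuantumManyBody.TranslationAverageCalculus
import Literature.MathematicalPhysics.QuantumManyBody.PeriodicBoseGasTagged
import Literature.MathematicalPhysics.QuantumManyBody.PeriodicBoseGasMomentumSector
import Mathlib.MeasureTheory.Integral.Lebesgue.DominatedConvergence
import HarnessLib

/-!
# The translation-averaged density on the torus and its regularised root

Topic `Literature/MathematicalPhysics/QuantumManyBody` (companion of `BosonicFloor.lean`: there the
density `|f|²` of an `M`-body function is symmetrised over the finite group of relabellings; here
it is averaged over the compact group of simultaneous translations `X ↦ X + t𝟙` of all particles on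
the torus `ℝ³/Lℤ³`). For `f : (ℝ³)^M → ℂ` of class `C¹`, `Lℤ³`-periodic in every particle, put
`F(X) = ∫_{[0,L)³} |f(X + t𝟙)|² dt` and `g_ε = √(ε² + F) − ε` (`ε > 0`; written out in full in every
statement, the lemmas named `…sqrtTransAvg…` concern `(g_ε : ℂ)`). Then

* `contDiff_sqrtTransAvg` : `g_ε` is `C¹` (differentiation under the integral sign,
  `TranslationAverageCalculus.lean`);
* `sqrtTransAvg_add_single`, `sqrtTransAvg_comp_perm`, `sqrtTransAvg_transl`,
  `hasTotalMomentum_zero_sqrtTransAvg` : `g_ε` is periodic, as symmetric as `f`, and INVARIANT under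
  the simultaneous translation of all particles (total momentum `0`: the cell integral of the
  `Lℤ³`-periodic `t ↦ |f(X + t𝟙)|²` is translation invariant, `lintegral_cell_comp_add`);
* `nnnorm_fderiv_sqrtTransAvg_sq_le` : the convexity inequality for gradients
  `‖D g_ε(X) u‖₊² ≤ ∫_{[0,L)³} ‖Df(X + t𝟙) u‖₊² dt` [LiebLoss2001, Thm. 7.8];
  `nnnorm_sqrtTransAvg_sq_le` : `‖g_ε(X)‖₊² ≤ ∫_{[0,L)³} ‖f(X + t𝟙)‖₊² dt`;
* `lintegral_cellN_lintegral_cell_comp_add` : `∫_{[0,L)^{3M}} ∫_{[0,L)³} G(X + t𝟙) dt dX = L³ ∫ G`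
  for periodic `G ≥ 0` (Tonelli and the shift of the fundamental cell);
* `tendsto_lintegral_nnnorm_sqrtTransAvg_sq` : `∫ ‖g_{1/(n+1)}‖₊² → L³ ∫ ‖f‖₊²` (dominated
  convergence).

These feed the proof that the infimum of a translation-invariant torus Hamiltonian over periodic
`C¹` states is approached inside the sector of total momentum `0` without Perron–Frobenius theory
(crux `RecoilTransfer` of `AtomisticToContinuum/BoseEinsteinCondensation`).

## References

* [LiebLoss2001] E. H. Lieb, M. Loss, *Analysis*, 2nd ed., AMS 2001, Thm. 7.8.
* [LSSY2005] E. H. Lieb, R. Seiringer, J. P. Solovej, J. Yngvason, *The Mathematics of the Bose Gas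
  and its Condensation*, Birkhäuser 2005, Ch. 2.
-/

noncomputable section

open MeasureTheory Filter Topology WithLp
open scoped ENNReal NNReal

namespace Literature.MathematicalPhysics.QuantumManyBody.BoseGas

variable {M : ℕ} {L : ℝ}

/-! ### The cell `[0,L)³` versus the closed box `[0,L]³` -/

/-- `[0,L)³` and the compact box `[0,L]³` agree up to a Lebesgue-null set. [folklore] -/
theorem cell_ae_eq_closedBox (L : ℝ) :
    cell L =ᵐ[volume] (toLp 2 '' Set.univ.pi fun _ : Fin 3 => Set.Icc (0 : ℝ) L : Set Space) := by
  have h1 : (toLp 2 '' Set.univ.pi fun _ : Fin 3 => Set.Icc (0 : ℝ) L : Set Space) =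
      (@ofLp 2 (Fin 3 → ℝ)) ⁻¹' (Set.univ.pi fun _ => Set.Icc 0 L) := by
    ext x
    constructor
    · rintro ⟨y, hy, rfl⟩
      simpa using hy
    · intro hx
      exact ⟨ofLp x, hx, rfl⟩
  have h2 : cell L = (@ofLp 2 (Fin 3 → ℝ)) ⁻¹' (Set.univ.pi fun _ => Set.Ico 0 L) := by
    ext x; simp [cell]
  have h3 : (Set.univ.pi fun _ : Fin 3 => Set.Icc (0 : ℝ) L) =
      Set.Icc (fun _ => (0 : ℝ)) fun _ => L :=
    Set.pi_univ_Icc _ _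
  rw [h1, h2, h3]
  refine (PiLp.volume_preserving_ofLp (Fin 3)).quasiMeasurePreserving.preimage_ae_eq ?_
  rw [volume_pi]
  exact Measure.univ_pi_Ico_ae_eq_Icc

/-- Bochner integrals over `[0,L)³` and over `[0,L]³` agree. [folklore] -/
theorem setIntegral_cell_eq_closedBox {E : Type*} [NormedAddCommGroup E] [NormedSpace ℝ E]
    (φ : Space → E) :
    ∫ t in cell L, φ t =
      ∫ t in (toLp 2 '' Set.univ.pi fun _ : Fin 3 => Set.Icc (0 : ℝ) L : Set Space), φ t :=
  setIntegral_congr_set (cell_ae_eq_closedBox L)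

/-- `ofReal (∫_{[0,L)³} ‖φ‖²) = ∫⁻_{[0,L)³} ‖φ‖₊²` for continuous `φ`. [folklore] -/
theorem ofReal_setIntegral_cell_norm_sq {E : Type*} [NormedAddCommGroup E] {φ : Space → E}
    (hφ : Continuous φ) :
    ENNReal.ofReal (∫ t in cell L, ‖φ t‖ ^ 2) = ∫⁻ t in cell L, ((‖φ t‖₊ : ℝ≥0∞)) ^ 2 := by
  rw [ofReal_integral_eq_lintegral_ofReal (integrableOn_cell (f := fun t => ‖φ t‖ ^ 2)
    (hφ.norm.pow 2)) (ae_of_all _ fun t => sq_nonneg _)]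
  exact lintegral_congr fun t => (coe_nnnorm_sq_eq_ofReal _).symm

/-- `∫_{[0,L)³} ‖φ‖² = (∫⁻_{[0,L)³} ‖φ‖₊²).toReal` for continuous `φ`. [folklore] -/
theorem setIntegral_cell_norm_sq_eq_toReal {E : Type*} [NormedAddCommGroup E] {φ : Space → E}
    (hφ : Continuous φ) :
    ∫ t in cell L, ‖φ t‖ ^ 2 = (∫⁻ t in cell L, ((‖φ t‖₊ : ℝ≥0∞)) ^ 2).toReal := by
  rw [← ofReal_setIntegral_cell_norm_sq hφ,
    ENNReal.toReal_ofReal (integral_nonneg fun _ => sq_nonneg _)]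

/-! ### Periodicity under common lattice shifts; shift of the one-particle cell -/

/-- A function of `M` particles that is `Lℤ³`-periodic in every particle and axis is invariant
under the simultaneous shift of all particles by `L e_k`. [folklore] -/
theorem periodic_add_const_single {α : Sort*} {G : Config M → α}
    (hG : ∀ (X : Config M) (i : Fin M) (k : Fin 3),
      G (X + Pi.single i (EuclideanSpace.single k L)) = G X)
    (X : Config M) (k : Fin 3) :
    G (X + fun _ => EuclideanSpace.single k L) = G X := by
  suffices h : ∀ s : Finset (Fin M),
      G (X + ∑ i ∈ s, Pi.single i (EuclideanSpace.single k L)) = G X by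
    rw [← Finset.univ_sum_single fun _ : Fin M => (EuclideanSpace.single k L : Space)]
    exact h _
  intro s
  induction s using Finset.induction_on with
  | empty => rw [Finset.sum_empty, add_zero]
  | insert i s hi ih => rw [Finset.sum_insert hi, add_comm (Pi.single i _) _, ← add_assoc, hG, ih]

/-- **Shift of the one-particle cell**: `∫_{[0,L)³} G(t + s) dt = ∫_{[0,L)³} G(t) dt` for
`Lℤ³`-periodic `G ≥ 0` (`0 < L`). [folklore] -/
theorem lintegral_cell_comp_add (hL : 0 < L) {G : Space → ℝ≥0∞}
    (hG : ∀ (t : Space) (k : Fin 3), G (t + EuclideanSpace.single k L) = G t) (s : Space) :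
    ∫⁻ t in cell L, G (t + s) = ∫⁻ t in cell L, G t := by
  rw [← lintegral_cellN_one L G, ← lintegral_cellN_one L fun t => G (t + s)]
  have h := lintegral_cellN_comp_add hL (G := fun Y : Config 1 => G (Y 0))
    (fun (Y : Config 1) (i : Fin 1) (k : Fin 3) => by
      show G ((Y + Pi.single i (EuclideanSpace.single k L) : Config 1) 0) = G (Y 0)
      rw [Pi.add_apply, Subsingleton.elim i 0, Pi.single_eq_same, hG]) (fun _ => s)
  simpa only [Pi.add_apply] using h

/-- **Tonelli and the shift of the fundamental cell**: for measurable `G ≥ 0` on `(ℝ³)^M`,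
`Lℤ³`-periodic in every particle and axis (`0 < L`),
`∫_{[0,L)^{3M}} ∫_{[0,L)³} G(X + t𝟙) dt dX = L³ · ∫_{[0,L)^{3M}} G`. [folklore] -/
theorem lintegral_cellN_lintegral_cell_comp_add (hL : 0 < L) {G : Config M → ℝ≥0∞}
    (hG : Measurable G)
    (hGper : ∀ (X : Config M) (i : Fin M) (k : Fin 3),
      G (X + Pi.single i (EuclideanSpace.single k L)) = G X) :
    ∫⁻ X in cellN M L, ∫⁻ t in cell L, G (X + fun _ => t) =
      ENNReal.ofReal L ^ 3 * ∫⁻ X in cellN M L, G X := by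
  have hm : Measurable fun p : Config M × Space => p.1 + fun _ => p.2 :=
    measurable_fst.add (measurable_pi_lambda _ fun _ => measurable_snd)
  have hmeas : AEMeasurable (Function.uncurry fun (X : Config M) (t : Space) => G (X + fun _ => t))
      ((volume.restrict (cellN M L)).prod (volume.restrict (cell L))) := (hG.comp hm).aemeasurable
  rw [lintegral_lintegral_swap hmeas]
  have h : ∀ t : Space, ∫⁻ X in cellN M L, G (X + fun _ => t) = ∫⁻ X in cellN M L, G X :=
    fun t => lintegral_cellN_comp_add hL hGper _
  simp only [h]
  rw [setLIntegral_const, volume_cell, mul_comm]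

/-! ### The regularised root of the translation-averaged density -/

section SqrtTransAvg

variable {f : Config M → ℂ} {ε : ℝ}

/-- The diagonal embedding `t ↦ t𝟙 = (t, …, t)` is continuous. [folklore] -/
theorem continuous_diagConfig : Continuous fun t : Space => (fun _ : Fin M => t : Config M) :=
  continuous_pi fun _ => continuous_id

/-- `g_ε = √(ε² + ∫_{[0,L)³} |f(· + t𝟙)|² dt) − ε` is `C¹` for `C¹` `f` and `ε > 0`. [folklore] -/
theorem contDiff_sqrtTransAvg (hf : ContDiff ℝ 1 f) (hε : 0 < ε) :
    ContDiff ℝ 1 (fun Y : Config M =>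
      ((Real.sqrt (ε ^ 2 + ∫ t in cell L, ‖f (Y + fun _ => t)‖ ^ 2) - ε : ℝ) : ℂ)) := by
  simp only [setIntegral_cell_eq_closedBox]
  exact contDiff_ofReal_sqrtAvg (μ := volume) hf continuous_diagConfig (isCompact_closedBox L) hε

/-- `g_ε` is continuous. [folklore] -/
theorem continuous_sqrtTransAvg (hf : ContDiff ℝ 1 f) (hε : 0 < ε) :
    Continuous (fun Y : Config M =>
      ((Real.sqrt (ε ^ 2 + ∫ t in cell L, ‖f (Y + fun _ => t)‖ ^ 2) - ε : ℝ) : ℂ)) :=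
  (contDiff_sqrtTransAvg hf hε).continuous

/-- **Convexity inequality for gradients, translation-averaged form**: for `C¹` `f`, `ε > 0` and
every direction `u`, `‖D g_ε(X) u‖₊² ≤ ∫_{[0,L)³} ‖Df(X + t𝟙) u‖₊² dt`.
[cite: LiebLoss2001, Thm. 7.8] -/
theorem nnnorm_fderiv_sqrtTransAvg_sq_le (hf : ContDiff ℝ 1 f) (hε : 0 < ε) (X u : Config M) :
    ((‖fderiv ℝ (fun Y : Config M =>
        ((Real.sqrt (ε ^ 2 + ∫ t in cell L, ‖f (Y + fun _ => t)‖ ^ 2) - ε : ℝ) : ℂ)) X u‖₊ :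
        ℝ≥0∞)) ^ 2 ≤
      ∫⁻ t in cell L, ((‖fderiv ℝ f (X + fun _ => t) u‖₊ : ℝ≥0∞)) ^ 2 := by
  have hφ : Continuous fun t : Space => fderiv ℝ f (X + fun _ => t) u :=
    ((hf.continuous_fderiv one_ne_zero).comp
      (continuous_const.add continuous_diagConfig)).clm_apply continuous_const
  rw [← ofReal_setIntegral_cell_norm_sq hφ]
  simp only [setIntegral_cell_eq_closedBox]
  exact nnnorm_fderiv_sqrtAvg_sq_le (μ := volume) hf continuous_diagConfig (isCompact_closedBox L)
    hε X u

/-- `‖g_ε(X)‖₊² ≤ ∫_{[0,L)³} ‖f(X + t𝟙)‖₊² dt` (from `g_ε² ≤ F`). [folklore] -/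
theorem nnnorm_sqrtTransAvg_sq_le (hf : Continuous f) (hε : 0 ≤ ε) (X : Config M) :
    ((‖((Real.sqrt (ε ^ 2 + ∫ t in cell L, ‖f (X + fun _ => t)‖ ^ 2) - ε : ℝ) : ℂ)‖₊ : ℝ≥0∞)) ^ 2 ≤
      ∫⁻ t in cell L, ((‖f (X + fun _ => t)‖₊ : ℝ≥0∞)) ^ 2 := by
  have hφ : Continuous fun t : Space => f (X + fun _ => t) :=
    hf.comp (continuous_const.add continuous_diagConfig)
  rw [← ofReal_setIntegral_cell_norm_sq hφ]
  exact nnnorm_ofReal_sqrtRegOf_sq_le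
    (F := fun Y : Config M => ∫ t in cell L, ‖f (Y + fun _ => t)‖ ^ 2)
    (integral_nonneg fun _ => sq_nonneg _) hε

/-- `g_ε` is periodic in every particle and axis when `f` is. [folklore] -/
theorem sqrtTransAvg_add_single
    (hper : ∀ (X : Config M) (i : Fin M) (k : Fin 3),
      f (X + Pi.single i (EuclideanSpace.single k L)) = f X)
    (ε : ℝ) (X : Config M) (i : Fin M) (k : Fin 3) :
    ((Real.sqrt (ε ^ 2 + ∫ t in cell L,
        ‖f (X + Pi.single i (EuclideanSpace.single k L) + fun _ => t)‖ ^ 2) - ε : ℝ) : ℂ) =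
      ((Real.sqrt (ε ^ 2 + ∫ t in cell L, ‖f (X + fun _ => t)‖ ^ 2) - ε : ℝ) : ℂ) := by
  have h : (fun t : Space => ‖f (X + Pi.single i (EuclideanSpace.single k L) + fun _ => t)‖ ^ 2) =
      fun t => ‖f (X + fun _ => t)‖ ^ 2 := funext fun t => by rw [add_right_comm, hper]
  rw [h]

/-- `g_ε` inherits every relabelling symmetry of `f`. [folklore] -/
theorem sqrtTransAvg_comp_perm {σ : Equiv.Perm (Fin M)} (hσ : ∀ Y : Config M, f (Y ∘ σ) = f Y)
    (ε : ℝ) (X : Config M) :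
    ((Real.sqrt (ε ^ 2 + ∫ t in cell L, ‖f ((X ∘ σ) + fun _ => t)‖ ^ 2) - ε : ℝ) : ℂ) =
      ((Real.sqrt (ε ^ 2 + ∫ t in cell L, ‖f (X + fun _ => t)‖ ^ 2) - ε : ℝ) : ℂ) := by
  have h : (fun t : Space => ‖f ((X ∘ σ) + fun _ => t)‖ ^ 2) = fun t => ‖f (X + fun _ => t)‖ ^ 2 :=
    funext fun t => by rw [← hσ (X + fun _ => t)]; rfl
  rw [h]

/-- **Translation invariance of the averaged density**: for continuous `f`, `Lℤ³`-periodic in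
every particle (`0 < L`), `∫_{[0,L)³} |f(X + s𝟙 + t𝟙)|² dt = ∫_{[0,L)³} |f(X + t𝟙)|² dt` (the cell
integral of the `Lℤ³`-periodic `t ↦ |f(X + t𝟙)|²` is translation invariant). [folklore] -/
theorem setIntegral_cell_norm_sq_transl (hL : 0 < L) (hf : Continuous f)
    (hper : ∀ (X : Config M) (i : Fin M) (k : Fin 3),
      f (X + Pi.single i (EuclideanSpace.single k L)) = f X)
    (X : Config M) (s : Space) :
    ∫ t in cell L, ‖f ((fun i => X i + s) + fun _ => t)‖ ^ 2 =
      ∫ t in cell L, ‖f (X + fun _ => t)‖ ^ 2 := by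
  have h1 : Continuous fun t : Space => f ((fun i => X i + s) + fun _ => t) :=
    hf.comp (continuous_const.add continuous_diagConfig)
  have h2 : Continuous fun t : Space => f (X + fun _ => t) :=
    hf.comp (continuous_const.add continuous_diagConfig)
  rw [setIntegral_cell_norm_sq_eq_toReal h1, setIntegral_cell_norm_sq_eq_toReal h2]
  congr 1
  have hG : ∀ (t : Space) (k : Fin 3),
      ((‖f (X + fun _ => t + EuclideanSpace.single k L)‖₊ : ℝ≥0∞)) ^ 2 =
        ((‖f (X + fun _ => t)‖₊ : ℝ≥0∞)) ^ 2 := fun t k => by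
    have h1 : (X + fun _ => t + EuclideanSpace.single k L) =
        (X + fun _ => t) + fun _ => EuclideanSpace.single k L := by
      funext i; simp only [Pi.add_apply, add_assoc]
    rw [h1, periodic_add_const_single (G := fun Y => ((‖f Y‖₊ : ℝ≥0∞)) ^ 2) (fun Y i k => by
      simp only [hper])]
  have key : (fun t : Space => ((‖f ((fun i => X i + s) + fun _ => t)‖₊ : ℝ≥0∞)) ^ 2) =
      fun t => ((‖f (X + fun _ => t + s)‖₊ : ℝ≥0∞)) ^ 2 := by
    funext t
    have h1 : ((fun i => X i + s) + fun _ => t) = X + fun _ => t + s := by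
      funext i; simp only [Pi.add_apply]; rw [add_assoc, add_comm s t]
    rw [h1]
  rw [key]
  exact lintegral_cell_comp_add hL (G := fun t => ((‖f (X + fun _ => t)‖₊ : ℝ≥0∞)) ^ 2) hG s

/-- `g_ε` is invariant under the simultaneous translation of all particles. [folklore] -/
theorem sqrtTransAvg_transl (hL : 0 < L) (hf : Continuous f)
    (hper : ∀ (X : Config M) (i : Fin M) (k : Fin 3),
      f (X + Pi.single i (EuclideanSpace.single k L)) = f X)
    (ε : ℝ) (s : Space) (X : Config M) :
    ((Real.sqrt (ε ^ 2 + ∫ t in cell L, ‖f ((fun i => X i + s) + fun _ => t)‖ ^ 2) - ε : ℝ) : ℂ) =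
      ((Real.sqrt (ε ^ 2 + ∫ t in cell L, ‖f (X + fun _ => t)‖ ^ 2) - ε : ℝ) : ℂ) := by
  rw [setIntegral_cell_norm_sq_transl hL hf hper]

/-- **The regularised root of the translation-averaged density has total momentum `0`.**
[folklore] -/
theorem hasTotalMomentum_zero_sqrtTransAvg (hL : 0 < L) (hf : Continuous f)
    (hper : ∀ (X : Config M) (i : Fin M) (k : Fin 3),
      f (X + Pi.single i (EuclideanSpace.single k L)) = f X) (ε : ℝ) :
    HasTotalMomentum 0 (fun Y : Config M =>
      ((Real.sqrt (ε ^ 2 + ∫ t in cell L, ‖f (Y + fun _ => t)‖ ^ 2) - ε : ℝ) : ℂ)) :=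
  hasTotalMomentum_zero_iff.2 fun s X => sqrtTransAvg_transl hL hf hper ε s X

/-- `∫_{[0,L)^{3M}} ∫_{[0,L)³} ‖f(X + t𝟙)‖₊² dt dX = L³ ∫_{[0,L)^{3M}} ‖f‖₊²`. [folklore] -/
theorem lintegral_lintegral_nnnorm_transl_sq (hL : 0 < L) (hf : Continuous f)
    (hper : ∀ (X : Config M) (i : Fin M) (k : Fin 3),
      f (X + Pi.single i (EuclideanSpace.single k L)) = f X) :
    ∫⁻ X in cellN M L, ∫⁻ t in cell L, ((‖f (X + fun _ => t)‖₊ : ℝ≥0∞)) ^ 2 =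
      ENNReal.ofReal L ^ 3 * ∫⁻ X in cellN M L, ((‖f X‖₊ : ℝ≥0∞)) ^ 2 :=
  lintegral_cellN_lintegral_cell_comp_add hL (G := fun Y => ((‖f Y‖₊ : ℝ≥0∞)) ^ 2)
    ((hf.measurable.nnnorm.coe_nnreal_ennreal).pow_const _) fun Y i k => by simp only [hper]

/-- `∫_{[0,L)^{3M}} ‖g_ε‖₊² ≤ L³ ∫_{[0,L)^{3M}} ‖f‖₊²`. [folklore] -/
theorem lintegral_nnnorm_sqrtTransAvg_sq_le (hL : 0 < L) (hf : Continuous f)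
    (hper : ∀ (X : Config M) (i : Fin M) (k : Fin 3),
      f (X + Pi.single i (EuclideanSpace.single k L)) = f X) (hε : 0 ≤ ε) :
    ∫⁻ X in cellN M L,
        ((‖((Real.sqrt (ε ^ 2 + ∫ t in cell L, ‖f (X + fun _ => t)‖ ^ 2) - ε : ℝ) : ℂ)‖₊ :
          ℝ≥0∞)) ^ 2 ≤
      ENNReal.ofReal L ^ 3 * ∫⁻ X in cellN M L, ((‖f X‖₊ : ℝ≥0∞)) ^ 2 := by
  rw [← lintegral_lintegral_nnnorm_transl_sq hL hf hper]
  exact lintegral_mono fun X => nnnorm_sqrtTransAvg_sq_le hf hε X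

/-- **Removing the regularisation**: `∫_{[0,L)^{3M}} ‖g_{1/(n+1)}‖₊² → L³ ∫_{[0,L)^{3M}} ‖f‖₊²`
(dominated convergence: `g_ε² ≤ F`, `∫ F = L³ ∫|f|² < ∞`, and `g_ε² → F` pointwise). [folklore] -/
theorem tendsto_lintegral_nnnorm_sqrtTransAvg_sq (hL : 0 < L) (hf : ContDiff ℝ 1 f)
    (hper : ∀ (X : Config M) (i : Fin M) (k : Fin 3),
      f (X + Pi.single i (EuclideanSpace.single k L)) = f X)
    (htop : ∫⁻ X in cellN M L, ((‖f X‖₊ : ℝ≥0∞)) ^ 2 ≠ ⊤) :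
    Tendsto (fun n : ℕ => ∫⁻ X in cellN M L,
        ((‖((Real.sqrt ((1 / ((n : ℝ) + 1)) ^ 2 + ∫ t in cell L, ‖f (X + fun _ => t)‖ ^ 2) -
          (1 / ((n : ℝ) + 1)) : ℝ) : ℂ)‖₊ : ℝ≥0∞)) ^ 2)
      atTop (𝓝 (ENNReal.ofReal L ^ 3 * ∫⁻ X in cellN M L, ((‖f X‖₊ : ℝ≥0∞)) ^ 2)) := by
  have hc : Continuous fun t : Space => (fun _ : Fin M => t : Config M) := continuous_diagConfig
  rw [← lintegral_lintegral_nnnorm_transl_sq hL hf.continuous hper]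
  refine tendsto_lintegral_of_dominated_convergence
    (fun X => ∫⁻ t in cell L, ((‖f (X + fun _ => t)‖₊ : ℝ≥0∞)) ^ 2) (fun n => ?_) (fun n => ?_)
    ?_ ?_
  · exact ((continuous_sqrtTransAvg hf
      Nat.one_div_pos_of_nat).measurable.nnnorm.coe_nnreal_ennreal).pow_const _
  · exact ae_of_all _ fun X => nnnorm_sqrtTransAvg_sq_le hf.continuous Nat.one_div_pos_of_nat.le X
  · rw [lintegral_lintegral_nnnorm_transl_sq hL hf.continuous hper]
    exact ENNReal.mul_ne_top (ENNReal.pow_ne_top ENNReal.ofReal_ne_top) htop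
  · refine ae_of_all _ fun X => ?_
    have h0 : 0 ≤ ∫ t in cell L, ‖f (X + fun _ => t)‖ ^ 2 := integral_nonneg fun _ => sq_nonneg _
    have hφ : Continuous fun t : Space => f (X + fun _ => t) :=
      hf.continuous.comp (continuous_const.add hc)
    have h := ENNReal.tendsto_ofReal (tendsto_sqrtReg_sq h0)
    rw [ofReal_setIntegral_cell_norm_sq hφ] at h
    refine h.congr fun n => ?_
    exact (nnnorm_ofReal_sqrtRegOf_sq_eq
      (fun Y : Config M => ∫ t in cell L, ‖f (Y + fun _ => t)‖ ^ 2) X _).symm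

end SqrtTransAvg

end Literature.MathematicalPhysics.QuantumManyBody.BoseGas

end
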